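import Mathlib

/-!
# Pair additivity of the depletion forces the dilute corner of Conjecture M″ (solo-blind, session 56; kernel K25)

Context (CLAIMS C197–C199, `work/lemmaD/LEMMA_D_s56.md`, paper §12.8 (8″)).  For hard-core bosons at
the XY point on the torus `ℤ³_L` write `N₀(n)` for the zero-mode occupation of the positive
`n`-particle ground state and `δₙ := n − N₀(n)` for its depletion.  Conjecture D (pair additivity
in the dilute corner) says that for fixed `n`, `δₙ = C(n,2)·κ/L² + o(L⁻²)` with the two-body
constant `κ = κ₃ = Z₄/(8π⁴G₀²) = 0.33215` (exact two-body solution, Prop. D.2).  This file certifies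
the arithmetic by which approximate pair additivity,

  `|δₘ − m(m−1)/2 · κ| ≤ ε`  for `m = n−1, n, n+1`,  with  `ε < κ/4`,

forces the two halves of Conjecture M″ at the particle number `n`:

* `pairAdditive_concave_step` — concavity of `N₀` at `n`:
  `N₀(n+1) − 2N₀(n) + N₀(n−1) = −(δₙ₊₁ − 2δₙ + δₙ₋₁) < 0`
  (the second difference of `m ↦ m(m−1)/2` is `1`, so the pair-additive parts contribute `−κ`
  and the errors at most `4ε < κ`);
* `pairAdditive_fraction_step` — strict decrease of the condensate fraction from `n` to `n+1`
  for `n ≥ 2`:  `N₀(n+1)/(n+1) < N₀(n)/n`, i.e. `δₙ/n < δₙ₊₁/(n+1)`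
  (the pair-additive parts give `n(n+1)κ/2` against errors `ε(2n+1) < n(n+1)κ/2`).

The particle number is a real parameter `n` (only `n ≥ 2` is used, in the second statement);
`a, b, c` stand for `δₙ₋₁, δₙ, δₙ₊₁`.  Pure real arithmetic; standard axioms only.  What is NOT
formalised: Conjecture D itself (a statement about ground states of the lattice gas).
-/

namespace Summit.AtomisticToContinuum.BoseEinsteinCondensation.Theorems

/-- Second difference of the pair count: `C(n+1,2) − 2·C(n,2) + C(n−1,2) = 1`, written over `ℝ`
and multiplied by `κ`. -/
theorem pairCount_second_difference (n κ : ℝ) :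
    (n + 1) * n / 2 * κ - 2 * (n * (n - 1) / 2 * κ) + (n - 1) * (n - 2) / 2 * κ = κ := by
  ring

/-- **Concavity step from approximate pair additivity.**  If the depletions `a = δₙ₋₁`, `b = δₙ`,
`c = δₙ₊₁` are within `ε` of the pair-additive values `m(m−1)κ/2` and `ε < κ/4`, then the
zero-mode occupation `N₀(m) = m − δₘ` is strictly concave at `n`:
`N₀(n+1) − 2 N₀(n) + N₀(n−1) < 0`. -/
theorem pairAdditive_concave_step (κ ε n a b c : ℝ) (hε : ε < κ / 4)
    (ha : |a - (n - 1) * (n - 2) / 2 * κ| ≤ ε) (hb : |b - n * (n - 1) / 2 * κ| ≤ ε)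
    (hc : |c - (n + 1) * n / 2 * κ| ≤ ε) :
    ((n + 1) - c) - 2 * (n - b) + ((n - 1) - a) < 0 := by
  have ha' := (abs_le.mp ha).1
  have hb' := (abs_le.mp hb).2
  have hc' := (abs_le.mp hc).1
  have key := pairCount_second_difference n κ
  nlinarith [ha', hb', hc', key, hε]

/-- The pair-additive parts of `c·n − b·(n+1)` (with `b = δₙ`, `c = δₙ₊₁` exactly pair additive)
equal `n(n+1)κ/2`. -/
theorem pairCount_fraction_identity (n κ : ℝ) :
    (n + 1) * n / 2 * κ * n - n * (n - 1) / 2 * κ * (n + 1) = n * (n + 1) / 2 * κ := by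
  ring

/-- **Fraction step from approximate pair additivity.**  For a real particle number `n ≥ 2`, if
`b = δₙ` and `c = δₙ₊₁` are within `ε` of `n(n−1)κ/2` and `(n+1)nκ/2` with `ε < κ/4`, then
`c·n − b·(n+1) > 0`, i.e. `δₙ/n < δₙ₊₁/(n+1)`. -/
theorem pairAdditive_cross_pos (κ ε n b c : ℝ) (hn : 2 ≤ n) (hε : ε < κ / 4)
    (hb : |b - n * (n - 1) / 2 * κ| ≤ ε) (hc : |c - (n + 1) * n / 2 * κ| ≤ ε) :
    0 < c * n - b * (n + 1) := by
  have hb' := (abs_le.mp hb).2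
  have hc' := (abs_le.mp hc).1
  have hε0 : 0 ≤ ε := le_trans (abs_nonneg _) hb
  have hκ : 0 < κ := by linarith
  have hn0 : 0 ≤ n := by linarith
  have hn1 : 0 ≤ n + 1 := by linarith
  -- multiply the one-sided bounds by the nonnegative factors `n` and `n + 1`
  have h1 : ((n + 1) * n / 2 * κ - ε) * n ≤ c * n :=
    mul_le_mul_of_nonneg_right (by linarith) hn0
  have h2 : b * (n + 1) ≤ (n * (n - 1) / 2 * κ + ε) * (n + 1) :=
    mul_le_mul_of_nonneg_right (by linarith) hn1
  have key := pairCount_fraction_identity n κ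
  -- `c n − b (n+1) ≥ n(n+1)κ/2 − ε(2n+1)` and `ε(2n+1) < κ(2n+1)/4 ≤ n(n+1)κ/2` for `n ≥ 2`
  have h3 : ε * (2 * n + 1) < κ / 4 * (2 * n + 1) :=
    mul_lt_mul_of_pos_right hε (by linarith)
  have h5 : 0 ≤ κ * (2 * n * n - 1) := mul_nonneg hκ.le (by nlinarith)
  have h4 : κ / 4 * (2 * n + 1) ≤ n * (n + 1) / 2 * κ := by linarith [h5]
  nlinarith [h1, h2, key, h3, h4]

/-- **Strict decrease of the condensate fraction from `n` to `n+1`** (`n ≥ 2`) under approximate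
pair additivity: `N₀(n+1)/(n+1) < N₀(n)/n` with `N₀(m) = m − δₘ`, `b = δₙ`, `c = δₙ₊₁`. -/
theorem pairAdditive_fraction_step (κ ε n b c : ℝ) (hn : 2 ≤ n) (hε : ε < κ / 4)
    (hb : |b - n * (n - 1) / 2 * κ| ≤ ε) (hc : |c - (n + 1) * n / 2 * κ| ≤ ε) :
    ((n + 1) - c) / (n + 1) < (n - b) / n := by
  have hpos := pairAdditive_cross_pos κ ε n b c hn hε hb hc
  have hn0 : 0 < n := by linarith
  have hn1 : 0 < n + 1 := by linarith
  have hq : 0 < (c * n - b * (n + 1)) / (n * (n + 1)) := div_pos hpos (mul_pos hn0 hn1)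
  have hid : (n - b) / n - ((n + 1) - c) / (n + 1) = (c * n - b * (n + 1)) / (n * (n + 1)) := by
    field_simp
    ring
  linarith [hq, hid]

/-- **The dilute corner of Conjecture M″, packaged.**  Under approximate pair additivity at
`n−1, n, n+1` with `ε < κ/4` and `n ≥ 2`: `N₀` is strictly concave at `n` AND the condensate
fraction strictly decreases from `n` to `n+1`. -/
theorem pairAdditive_corner (κ ε n a b c : ℝ) (hn : 2 ≤ n) (hε : ε < κ / 4)
    (ha : |a - (n - 1) * (n - 2) / 2 * κ| ≤ ε) (hb : |b - n * (n - 1) / 2 * κ| ≤ ε)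
    (hc : |c - (n + 1) * n / 2 * κ| ≤ ε) :
    ((n + 1) - c) - 2 * (n - b) + ((n - 1) - a) < 0 ∧ ((n + 1) - c) / (n + 1) < (n - b) / n :=
  ⟨pairAdditive_concave_step κ ε n a b c hε ha hb hc,
   pairAdditive_fraction_step κ ε n b c hn hε hb hc⟩

end Summit.AtomisticToContinuum.BoseEinsteinCondensation.Theorems
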